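import Summits.ResolutionOfSingularities.ResolutionOfSingularities.Theorems.HomologicalConductorNoZenoSplitExcCount
import Literature.AlgebraicGeometry.Resolution.MinimalResolutionUnique
import HarnessLib

/-!
# Crux `NoZenoR` / `NoZeno` (stmt-ResolutionOfSingularities-19943 / -16483), β2 descent, `stub_L1wCore` bricks:
# the split count `N^s` is an INVARIANT — transport along isomorphisms over the base, and
# «`HasSplitExcCurveCountLE R N` can be read off ANY minimal resolution»

OURS (cell res-hironaka, chain W4.4; stub worker res-L0-w44-stub-2 g11; plan `L1W-PREP.md` 4a61d05beab993ff §3.4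
G0 «count transport», CHAIN v18 §2 row stub-2 «GO»).  Nothing here is a statement of the manuscript under review;
AI-written, weaker than expert review.

U8's `HasSplitExcCurveCountLE R N` is an ∃-statement («SOME minimal resolution has finitely many integral exceptional
curves with split count `≤ N`»); the geometric core of (L1-w) (res-L0-w44-lead-1's `Sig.L1Core`, bricks (c1)–(c4))
works on the minimal resolution it is GIVEN (the one blown up in `IsSepX1Sandwiched`).  This file closes the ∃/∀ gap:

* `height_iso_apply` — an isomorphism of schemes is an order isomorphism for Mathlib's specialisation order
  (`Scheme.le_iff_specializes`), so `Order.height` is preserved;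
* `mem_excCurvePoints_iso_iff`, `excCurvePoints_iso_image`, `excCurvePoints_finite_iso_iff` — the integral exceptional
  curves correspond under an isomorphism over `Spec R`;
* `splitWeight_comp_of_isOpenImmersion` — the split weight of `η` for `f ≫ π` equals that of `f η` for `π` whenever
  `f` induces an isomorphism of residue fields at `η` (any open immersion, in particular an isomorphism): the two
  separable closures are identified by `separableClosure.algEquivOfAlgEquiv`;
* `splitExcCount_iso` — `N^s(e.hom ≫ π) = N^s(π)` for an isomorphism `e`;
* `splitExcCount_eq_of_isMinimalResolution`, `HasSplitExcCurveCountLE.finite_and_le` — with the tree's G0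
  (`IsMinimalResolution.nonempty_iso`, `Literature/…/MinimalResolutionUnique`): any two minimal resolutions of
  `Spec R` have the same finiteness of exceptional curves and the same `N^s`; hence `HasSplitExcCurveCountLE R N`
  gives `(excCurvePoints π).Finite ∧ splitExcCount π ≤ N` on EVERY minimal resolution `π`.
-/

noncomputable section

-- single-problem summit: the doubled namespace component `ResolutionOfSingularities` is forced
set_option linter.dupNamespace false

namespace Summit.ResolutionOfSingularities.ResolutionOfSingularities.Theorems.NoZeno.ExcCount

open CategoryTheory AlgebraicGeometry IsLocalRing
open Literature.AlgebraicGeometry.Resolution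

/-! ## Isomorphisms of schemes preserve the specialisation order and `Order.height` -/

/-- **`Order.height` is preserved by isomorphisms of schemes**: an isomorphism is an order isomorphism for
Mathlib's specialisation order (`Scheme.le_iff_specializes : a ≤ b ↔ b ⤳ a`), and `Order.height_orderIso`.
[folklore] -/
theorem height_iso_apply {X Y : Scheme.{0}} (e : X ≅ Y) (x : X) :
    Order.height (e.hom.base x) = Order.height x := by
  let f : X ≃o Y :=
    { toEquiv := (Scheme.homeoOfIso e).toEquiv
      map_rel_iff' := by
        intro a b
        change (Scheme.homeoOfIso e) a ≤ (Scheme.homeoOfIso e) b ↔ a ≤ b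
        rw [Scheme.le_iff_specializes, Scheme.le_iff_specializes]
        constructor
        · intro h
          have h' := h.map (Scheme.homeoOfIso e).symm.continuous
          simpa using h'
        · intro h
          exact h.map (Scheme.homeoOfIso e).continuous }
  exact Order.height_orderIso f x

/-! ## Exceptional curves under an isomorphism over the base -/

variable {R : Type} [CommRing R] [IsLocalRing R]

/-- For an isomorphism `e : X₁ ≅ X₂` over `Spec R` (`π₁ = e.hom ≫ π₂`), `η` is (the generic point of) an integral
exceptional curve of `π₁` iff `e η` is one of `π₂`. [this work] -/
theorem mem_excCurvePoints_iso_iff {X₁ X₂ : Scheme.{0}} (e : X₁ ≅ X₂) (π₂ : X₂ ⟶ Spec (.of R)) (η : X₁) :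
    η ∈ excCurvePoints (e.hom ≫ π₂) ↔ e.hom.base η ∈ excCurvePoints π₂ := by
  simp only [excCurvePoints, Set.mem_setOf_eq, height_iso_apply]
  exact Iff.rfl

/-- The exceptional curves of `e.hom ≫ π₂` are carried bijectively onto those of `π₂`. [this work] -/
theorem excCurvePoints_bijOn_iso {X₁ X₂ : Scheme.{0}} (e : X₁ ≅ X₂) (π₂ : X₂ ⟶ Spec (.of R)) :
    Set.BijOn e.hom.base (excCurvePoints (e.hom ≫ π₂)) (excCurvePoints π₂) := by
  refine ⟨fun η hη => (mem_excCurvePoints_iso_iff e π₂ η).mp hη,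
    fun a _ b _ hab => (Scheme.homeoOfIso e).injective hab, fun θ hθ => ?_⟩
  have hθ' : e.hom.base (e.inv.base θ) = θ := (Scheme.homeoOfIso e).apply_symm_apply θ
  refine ⟨e.inv.base θ, ?_, hθ'⟩
  rw [mem_excCurvePoints_iso_iff, hθ']
  exact hθ

/-- The image of the exceptional curves under the isomorphism. [this work] -/
theorem excCurvePoints_iso_image {X₁ X₂ : Scheme.{0}} (e : X₁ ≅ X₂) (π₂ : X₂ ⟶ Spec (.of R)) :
    e.hom.base '' excCurvePoints (e.hom ≫ π₂) = excCurvePoints π₂ :=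
  (excCurvePoints_bijOn_iso e π₂).image_eq

/-- Finiteness of the exceptional curves is invariant. [this work] -/
theorem excCurvePoints_finite_iso_iff {X₁ X₂ : Scheme.{0}} (e : X₁ ≅ X₂) (π₂ : X₂ ⟶ Spec (.of R)) :
    (excCurvePoints (e.hom ≫ π₂)).Finite ↔ (excCurvePoints π₂).Finite := by
  rw [← excCurvePoints_iso_image e π₂]
  exact (Set.finite_image_iff (excCurvePoints_bijOn_iso e π₂).injOn).symm

/-! ## The split weight under a morphism inducing an isomorphism of residue fields -/

omit [IsLocalRing R] in
/-- **The split weight is computed upstairs or downstairs alike along an open immersion** (in particular an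
isomorphism): for `f : X₁ ⟶ X₂` an open immersion and `π : X₂ ⟶ Spec R`, `splitWeight (f ≫ π) η = splitWeight π (f η)`
— `f.residueFieldMap η : κ(f η) ⟶ κ(η)` is an isomorphism of `κ(π (f η))`-algebras (`residueFieldMap_comp`), and
separable closures are transported along algebra isomorphisms (`separableClosure.algEquivOfAlgEquiv`). [this work] -/
theorem splitWeight_comp_of_isOpenImmersion {X₁ X₂ : Scheme.{0}} (f : X₁ ⟶ X₂) [IsOpenImmersion f]
    (π : X₂ ⟶ Spec (.of R)) (η : X₁) :
    splitWeight (f ≫ π) η = splitWeight π (f.base η) := by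
  unfold splitWeight
  -- the common base field `k = κ(π (f η))` and the two algebra structures
  set k := (Spec (.of R)).residueField ((f ≫ π).base η) with hk
  letI alg₁ : Algebra k (X₁.residueField η) := ((f ≫ π).residueFieldMap η).hom.toAlgebra
  letI alg₂ : Algebra k (X₂.residueField (f.base η)) := (π.residueFieldMap (f.base η)).hom.toAlgebra
  -- the residue field isomorphism, as a `k`-algebra isomorphism
  let φ : X₂.residueField (f.base η) ≅ X₁.residueField η := asIso (f.residueFieldMap η)
  have hφ : ∀ a : k, φ.hom.hom (algebraMap k (X₂.residueField (f.base η)) a) =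
      algebraMap k (X₁.residueField η) a := by
    intro a
    change (π.residueFieldMap (f.base η) ≫ f.residueFieldMap η).hom a = ((f ≫ π).residueFieldMap η).hom a
    rw [Scheme.residueFieldMap_comp]
    rfl
  let i : X₂.residueField (f.base η) ≃ₐ[k] X₁.residueField η :=
    AlgEquiv.ofRingEquiv (f := φ.commRingCatIsoToRingEquiv) hφ
  have h := (separableClosure.algEquivOfAlgEquiv i).toLinearEquiv.finrank_eq
  -- `finrank k (separableClosure k κ(f η)) = finrank k (separableClosure k κ(η))`
  change max 1 (Module.finrank k (separableClosure k (X₁.residueField η))) =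
    max 1 (Module.finrank k (separableClosure k (X₂.residueField (f.base η))))
  rw [h]

/-! ## `N^s` along an isomorphism over the base -/

/-- **`N^s(e.hom ≫ π) = N^s(π)`** for an isomorphism `e : X₁ ≅ X₂` of schemes over `Spec R`. [this work] -/
theorem splitExcCount_iso {X₁ X₂ : Scheme.{0}} (e : X₁ ≅ X₂) (π₂ : X₂ ⟶ Spec (.of R)) :
    splitExcCount (e.hom ≫ π₂) = splitExcCount π₂ := by
  unfold splitExcCount
  exact finsum_mem_eq_of_bijOn e.hom.base (excCurvePoints_bijOn_iso e π₂)
    fun η _ => splitWeight_comp_of_isOpenImmersion e.hom π₂ η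

/-! ## Any two minimal resolutions have the same `N^s` (with G0 `IsMinimalResolution.nonempty_iso`) -/

/-- **Two minimal resolutions of `Spec R` have the same split count and the same finiteness of exceptional curves.**
[this work] -/
theorem splitExcCount_eq_of_isMinimalResolution {X₁ X₂ : Scheme.{0}} {π₁ : X₁ ⟶ Spec (.of R)}
    {π₂ : X₂ ⟶ Spec (.of R)} (h₁ : IsMinimalResolution π₁) (h₂ : IsMinimalResolution π₂) :
    splitExcCount π₁ = splitExcCount π₂ ∧
      ((excCurvePoints π₁).Finite ↔ (excCurvePoints π₂).Finite) := by
  obtain ⟨e, he⟩ := h₁.nonempty_iso h₂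
  subst he
  exact ⟨splitExcCount_iso e π₂, excCurvePoints_finite_iso_iff e π₂⟩

/-- **`HasSplitExcCurveCountLE R N` read off ANY minimal resolution**: if `N^s(R) ≤ N` (U8's ∃-form) and
`π : X ⟶ Spec R` is a minimal resolution, then `π` has finitely many integral exceptional curves and
`splitExcCount π ≤ N`. [this work] -/
theorem HasSplitExcCurveCountLE.finite_and_le {N : ℕ} (h : HasSplitExcCurveCountLE R N) {X : Scheme.{0}}
    {π : X ⟶ Spec (.of R)} (hπ : IsMinimalResolution π) :
    (excCurvePoints π).Finite ∧ splitExcCount π ≤ N := by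
  obtain ⟨X₀, π₀, h₀, hfin₀, hle₀⟩ := h
  obtain ⟨hcount, hfin⟩ := splitExcCount_eq_of_isMinimalResolution hπ h₀
  exact ⟨hfin.mpr hfin₀, hcount ▸ hle₀⟩

/-- Conversely (trivially), a minimal resolution with finitely many exceptional curves and `N^s ≤ N` witnesses
`HasSplitExcCurveCountLE R N`; so for a ring WITH a minimal resolution `π`, `HasSplitExcCurveCountLE R N ↔
(excCurvePoints π).Finite ∧ splitExcCount π ≤ N`. [this work] -/
theorem hasSplitExcCurveCountLE_iff_of_isMinimalResolution {N : ℕ} {X : Scheme.{0}} {π : X ⟶ Spec (.of R)}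
    (hπ : IsMinimalResolution π) :
    HasSplitExcCurveCountLE R N ↔ (excCurvePoints π).Finite ∧ splitExcCount π ≤ N :=
  ⟨fun h => h.finite_and_le hπ, fun h => ⟨X, π, hπ, h.1, h.2⟩⟩

end Summit.ResolutionOfSingularities.ResolutionOfSingularities.Theorems.NoZeno.ExcCount

end
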